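import Literature.Probability.Process.BrownianVecHarmonic
import Literature.Probability.Process.NewtonPotential
import HarnessLib

/-!
# The spatial part of four-dimensional Brownian motion: hitting estimate, polarity of the axis, transience

Topic `Probability/Process`. Let `W` be a four-dimensional Brownian motion (`IsBrownianVec`,
`d = 4`) and write `X_t = x₀ + W_t = (x_t, w_t)` with `w_t ∈ ℝ³` the last three coordinates,
`|w| = spRad` (`NewtonPotential`). The process `w` is a three-dimensional Brownian motion, and we
prove for it the classical facts of Le Gall (2016), Ch. 7, Prop. 7.16 and Thm. 7.17 (ii), in the
form needed for the Brownian excursion `x + i|w|` of [LSW] §4: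

* `IsBrownianVec.measure_hit_inner_le` — **the hitting estimate**: for `0 < ε < |w₀| < R`, the
  probability that `|w|` reaches the level `ε` before time `t` and before the level `R` is at most
  `ε/|w₀|` — optional stopping (`integral_stoppedProcess_eq_of_harmonic'`) for the Newtonian
  potential `|w|⁻¹` (`lap_newton_eq_zero`) and Markov's inequality; hence
  `measure_hitTime_inner_ne_top_le`: `P(|w| ever ≤ ε) ≤ ε/|w₀|` ((7.4) of Le Gall with `R → ∞`);
* `IsBrownianVec.measure_exists_spRad_eq_zero` — **the axis `{w = 0}` is polar** from every
  starting point off the axis (Prop. 7.16: "`P_x(U_0 < ∞) = 0`");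
* `IsBrownianVec.measure_exists_spRad_eq_zero_of_le` — from ANY starting point, almost surely
  `w_s ≠ 0` for all `s ≥ s₀ > 0` (weak Markov property at time `s₀`, the Gaussian marginal does
  not charge the axis); hence `ae_forall_pos_spRad_pos`: a.s. `|w_s| > 0` for all `s > 0`;
* `IsBrownianVec.ae_tendsto_spRad_atTop` — **transience**: `|w_t| → ∞` almost surely
  (Thm. 7.17 (ii)), by the hitting estimate applied after time `n` (weak Markov property) and the
  spreading of the Gaussian marginals.

Everything is proved from the hypothesis structure; no named fact is introduced.

## References

* J.-F. Le Gall, *Brownian Motion, Martingales, and Stochastic Calculus*, GTM 274 (2016), Ch. 7,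
  Prop. 7.16 ((7.4) and "`P_x(U_0 < ∞) = 0` [...] points are polar") and Thm. 7.17 (ii) ("In
  dimension `d ≥ 3`, Brownian motion is transient, meaning that `lim_{t→∞} |B_t| = ∞` a.s.").
  [Legall2016]
-/

noncomputable section

open MeasureTheory ProbabilityTheory Filter Topology Set Metric
open scoped NNReal ENNReal BigOperators

namespace Literature.Probability.Process

/-! ### The level sets of `|w|` -/

/-- `{|w| ≤ ε}`. [folklore] -/
def innerSet (ε : ℝ) : Set (Fin 4 → ℝ) := {v | spRad v ≤ ε}

/-- `{R ≤ |w|}`. [folklore] -/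
def outerSet (R : ℝ) : Set (Fin 4 → ℝ) := {v | R ≤ spRad v}

/-- `{|w| ≤ ε}` is closed. [folklore] -/
theorem isClosed_innerSet (ε : ℝ) : IsClosed (innerSet ε) := isClosed_le continuous_spRad continuous_const

/-- `{R ≤ |w|}` is closed. [folklore] -/
theorem isClosed_outerSet (R : ℝ) : IsClosed (outerSet R) := isClosed_le continuous_const continuous_spRad

/-- `|v 1| ≤ |w|`. [folklore] -/
theorem abs_apply_one_le_spRad (v : Fin 4 → ℝ) : |v 1| ≤ spRad v := by
  rw [← Real.sqrt_sq_eq_abs, spRad]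
  exact Real.sqrt_le_sqrt (by simp only [spSq]; nlinarith [sq_nonneg (v 2), sq_nonneg (v 3)])

/-- If `|w| = 0` then the coordinate `v 1` vanishes. [folklore] -/
theorem apply_one_eq_zero_of_spRad_eq_zero {v : Fin 4 → ℝ} (h : spRad v = 0) : v 1 = 0 := by
  have := abs_apply_one_le_spRad v
  rw [h] at this
  exact abs_nonpos_iff.1 this

namespace IsBrownianVec

variable {Ω : Type*} {mΩ : MeasurableSpace Ω} {P : Measure Ω} {W : ℝ≥0 → Ω → (Fin 4 → ℝ)}

/-! ### The hitting estimate `P(|w| reaches ε before t and before R) ≤ ε/|w₀|` -/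

/-- **The hitting estimate (Le Gall (7.4), one-sided form).** For `0 < ε < |w₀| < R` and every
`t`: `P(T_{|w|≤ε} ≤ t, T_{|w|≥R} > t) ≤ ε / |w₀|`, where `w₀` is the spatial part of `x₀`.
[cite: Legall2016, Ch. 7 Prop. 7.16 (7.4)] -/
theorem measure_hit_inner_le [IsProbabilityMeasure P] (hW : IsBrownianVec W P) {x₀ : Fin 4 → ℝ}
    {ε R : ℝ} (hε : 0 < ε) (hεx : ε < spRad x₀) (hxR : spRad x₀ < R) (t : ℝ≥0) :
    P {ω | hitTime x₀ W (innerSet ε) ω ≤ t ∧ ¬ hitTime x₀ W (outerSet R) ω ≤ t} ≤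
      ENNReal.ofReal (ε / spRad x₀) := by
  have hr₀ : 0 < spRad x₀ := hε.trans hεx
  set F : Set (Fin 4 → ℝ) := innerSet ε ∪ outerSet R with hFdef
  have hF : IsClosed F := (isClosed_innerSet ε).union (isClosed_outerSet R)
  -- `closure Fᶜ ⊆ S = {ε ≤ |w| ≤ R} ⊆ offAxis`
  set S : Set (Fin 4 → ℝ) := {v | ε ≤ spRad v ∧ spRad v ≤ R} with hSdef
  have hS : IsClosed S := (isClosed_le continuous_const continuous_spRad).inter
    (isClosed_le continuous_spRad continuous_const)
  have hFS : closure Fᶜ ⊆ S := closure_minimal (fun v hv ↦ by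
    simp only [hFdef, mem_compl_iff, mem_union, innerSet, outerSet, mem_setOf_eq, not_or, not_le] at hv
    exact ⟨hv.1.le, hv.2.le⟩) hS
  have hSoff : S ⊆ offAxis := fun v hv ↦ mem_offAxis_iff_spRad_pos.2 (hε.trans_le hv.1)
  have hbound : ∀ y ∈ closure Fᶜ, |newton y| ≤ ε⁻¹ := fun y hy ↦ by
    rw [abs_of_nonneg (newton_nonneg y)]
    exact newton_le_inv hε (hFS hy).1
  have hx₀ : x₀ ∉ F := by
    simp only [hFdef, mem_union, innerSet, outerSet, mem_setOf_eq, not_or, not_le]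
    exact ⟨hεx, hxR⟩
  obtain ⟨hint, hE⟩ := hW.integral_stoppedProcess_eq_of_harmonic' isOpen_offAxis contDiffOn_newton
    (fun y hy ↦ lap_newton_eq_zero hy) hF (hFS.trans hSoff) hbound hx₀ t
  set SV := stoppedProcess (fun r ω ↦ newton (x₀ + W r ω)) (hitTime x₀ W F) t with hSV
  -- Markov's inequality
  have hnonneg : 0 ≤ᵐ[P] SV := ae_of_all _ fun ω ↦ newton_nonneg _
  have hmarkov := mul_meas_ge_le_integral_of_nonneg hnonneg hint ε⁻¹
  rw [hE, newton] at hmarkov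
  have hreal : P.real {ω | ε⁻¹ ≤ SV ω} ≤ ε / spRad x₀ := by
    rw [le_div_iff₀ hr₀]
    have := mul_le_mul_of_nonneg_left hmarkov hε.le
    rw [← mul_assoc, mul_inv_cancel₀ hε.ne', one_mul] at this
    calc P.real {ω | ε⁻¹ ≤ SV ω} * spRad x₀ = spRad x₀ * P.real {ω | ε⁻¹ ≤ SV ω} := mul_comm _ _
      _ ≤ spRad x₀ * (ε * (spRad x₀)⁻¹) := by gcongr
      _ = ε := by field_simp
  -- the event is contained in `{ε⁻¹ ≤ SV}`
  have hsub : {ω | hitTime x₀ W (innerSet ε) ω ≤ t ∧ ¬ hitTime x₀ W (outerSet R) ω ≤ t} ⊆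
      {ω | ε⁻¹ ≤ SV ω} := by
    rintro ω ⟨hin, hout⟩
    -- `T_F ≤ T_in ≤ t`, so `T_F = τ ≤ t`
    have hFle : hitTime x₀ W F ω ≤ t := (hitTime_mono Set.subset_union_left ω).trans hin
    obtain ⟨τ, hτ⟩ := WithTop.ne_top_iff_exists.1 (ne_top_of_le_ne_top WithTop.coe_ne_top hFle)
    have hτt : τ ≤ t := by rw [← hτ] at hFle; exact_mod_cast hFle
    have hmemF : x₀ + W τ ω ∈ F := hW.mem_of_hitTime_eq_coe hF hτ.symm
    have hnot_out : x₀ + W τ ω ∉ outerSet R := fun h ↦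
      hout ((hitTime_le_of_mem h).trans (by exact_mod_cast hτt))
    have hmem_in : x₀ + W τ ω ∈ innerSet ε := hmemF.resolve_right hnot_out
    -- the stopped clock is `τ` and the stopped point lies in `closure Fᶜ ⊆ S`
    have hclock : (min (t : WithTop ℝ≥0) (hitTime x₀ W F ω)).untopA = τ := by
      rw [← hτ, untopA_min_coe_coe, min_eq_right hτt]
    have hclS : x₀ + W τ ω ∈ S := hFS (hclock ▸ hW.mem_closure_compl_of_le hF hx₀ t ω le_rfl)
    show ε⁻¹ ≤ SV ω
    simp only [hSV, stoppedProcess, hclock]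
    exact inv_le_newton (hε.trans_le hclS.1) hmem_in
  calc P {ω | hitTime x₀ W (innerSet ε) ω ≤ t ∧ ¬ hitTime x₀ W (outerSet R) ω ≤ t}
      ≤ P {ω | ε⁻¹ ≤ SV ω} := measure_mono hsub
    _ = ENNReal.ofReal (P.real {ω | ε⁻¹ ≤ SV ω}) := (ofReal_measureReal (measure_ne_top _ _)).symm
    _ ≤ ENNReal.ofReal (ε / spRad x₀) := ENNReal.ofReal_le_ofReal hreal

/-- The path's spatial radius is bounded on `[0, t]` by some natural number exceeding any given
bound. [folklore] -/
theorem exists_nat_gt_spRad (hW : IsBrownianVec W P) (x₀ : Fin 4 → ℝ) (t : ℝ≥0) (ω : Ω) (b : ℝ) :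
    ∃ R : ℕ, b < R ∧ ∀ s ≤ t, spRad (x₀ + W s ω) < R := by
  have hcont : Continuous fun s : ℝ≥0 ↦ spRad (x₀ + W s ω) :=
    continuous_spRad.comp (continuous_const.add (hW.continuous_path ω))
  obtain ⟨M, hM⟩ := (isCompact_Icc (a := (0 : ℝ≥0)) (b := t)).bddAbove_image hcont.continuousOn
  obtain ⟨R, hR⟩ := exists_nat_gt (max M b)
  refine ⟨R, (le_max_right _ _).trans_lt hR, fun s hs ↦ ?_⟩
  exact ((hM ⟨s, ⟨bot_le, hs⟩, rfl⟩).trans (le_max_left _ _)).trans_lt hR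

/-- **`P(|w| reaches the level ε by time t) ≤ ε / |w₀|`** for `0 < ε < |w₀|` (Le Gall (7.4)
with `R → ∞`). [cite: Legall2016, Ch. 7 Prop. 7.16] -/
theorem measure_hitTime_inner_le_coe_le [IsProbabilityMeasure P] (hW : IsBrownianVec W P)
    {x₀ : Fin 4 → ℝ} {ε : ℝ} (hε : 0 < ε) (hεx : ε < spRad x₀) (t : ℝ≥0) :
    P {ω | hitTime x₀ W (innerSet ε) ω ≤ t} ≤ ENNReal.ofReal (ε / spRad x₀) := by
  set E : ℕ → Set Ω := fun R ↦
    {ω | hitTime x₀ W (innerSet ε) ω ≤ t ∧ ¬ hitTime x₀ W (outerSet R) ω ≤ t} with hE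
  have hbound : ∀ R, P (E R) ≤ ENNReal.ofReal (ε / spRad x₀) := by
    intro R
    by_cases hR : spRad x₀ < R
    · exact hW.measure_hit_inner_le hε hεx hR t
    · -- the second condition fails at time `0`
      have : E R = ∅ := by
        ext ω
        simp only [hE, mem_setOf_eq, mem_empty_iff_false, iff_false, not_and, not_not]
        intro _
        have h0 : x₀ + W 0 ω ∈ outerSet R := by
          show (R : ℝ) ≤ spRad (x₀ + W 0 ω)
          rw [hW.apply_zero, add_zero]; exact not_lt.1 hR
        exact (hitTime_le_of_mem h0).trans (by exact_mod_cast bot_le)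
      rw [this, measure_empty]
      exact bot_le
  have hsub : {ω | hitTime x₀ W (innerSet ε) ω ≤ t} ⊆ ⋃ R, E R := by
    intro ω hω
    obtain ⟨R, -, hR⟩ := hW.exists_nat_gt_spRad x₀ t ω 0
    refine mem_iUnion.2 ⟨R, hω, fun h ↦ ?_⟩
    obtain ⟨j, hj, hjmem⟩ := (hW.hitTime_le_coe_iff (isClosed_outerSet R)).1 h
    exact absurd hjmem (not_le.2 (hR j hj))
  have hmono : Monotone E := fun R R' hRR' ω hω ↦ ⟨hω.1, fun h ↦ hω.2
    ((hitTime_mono (fun v (hv : (R' : ℝ) ≤ spRad v) ↦ le_trans (by exact_mod_cast hRR') hv) ω).trans h)⟩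
  calc P {ω | hitTime x₀ W (innerSet ε) ω ≤ t} ≤ P (⋃ R, E R) := measure_mono hsub
    _ = ⨆ R, P (E R) := hmono.measure_iUnion
    _ ≤ ENNReal.ofReal (ε / spRad x₀) := iSup_le hbound

/-- **`P(|w| ever reaches the level ε) ≤ ε / |w₀|`** for `0 < ε < |w₀|` (Le Gall (7.4) with
`R → ∞`, then `t → ∞`). [cite: Legall2016, Ch. 7 Prop. 7.16] -/
theorem measure_hitTime_inner_ne_top_le [IsProbabilityMeasure P] (hW : IsBrownianVec W P)
    {x₀ : Fin 4 → ℝ} {ε : ℝ} (hε : 0 < ε) (hεx : ε < spRad x₀) :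
    P {ω | hitTime x₀ W (innerSet ε) ω ≠ ⊤} ≤ ENNReal.ofReal (ε / spRad x₀) := by
  have hsub : {ω | hitTime x₀ W (innerSet ε) ω ≠ ⊤} ⊆ ⋃ n : ℕ, {ω | hitTime x₀ W (innerSet ε) ω ≤ (n : ℝ≥0)} := by
    intro ω hω
    obtain ⟨T, hT⟩ := WithTop.ne_top_iff_exists.1 hω
    obtain ⟨n, hn⟩ := exists_nat_ge T
    refine mem_iUnion.2 ⟨n, ?_⟩
    show hitTime x₀ W (innerSet ε) ω ≤ (n : ℝ≥0)
    rw [← hT]; exact_mod_cast hn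
  have hmono : Monotone fun n : ℕ ↦ {ω | hitTime x₀ W (innerSet ε) ω ≤ (n : ℝ≥0)} :=
    fun n n' hnn' ω (hω : hitTime x₀ W (innerSet ε) ω ≤ (n : ℝ≥0)) ↦ hω.trans (by exact_mod_cast hnn')
  calc P {ω | hitTime x₀ W (innerSet ε) ω ≠ ⊤}
      ≤ P (⋃ n : ℕ, {ω | hitTime x₀ W (innerSet ε) ω ≤ (n : ℝ≥0)}) := measure_mono hsub
    _ = ⨆ n : ℕ, P {ω | hitTime x₀ W (innerSet ε) ω ≤ (n : ℝ≥0)} := hmono.measure_iUnion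
    _ ≤ ENNReal.ofReal (ε / spRad x₀) := iSup_le fun n ↦ hW.measure_hitTime_inner_le_coe_le hε hεx n

/-! ### The axis is polar -/

/-- **The axis `{w = 0}` is polar from a starting point off the axis** (Le Gall Prop. 7.16:
"`P_x(U_0 < ∞) = 0`", for the three-dimensional Brownian motion `w`).
[cite: Legall2016, Ch. 7 Prop. 7.16] -/
theorem measure_exists_spRad_eq_zero [IsProbabilityMeasure P] (hW : IsBrownianVec W P)
    {x₀ : Fin 4 → ℝ} (hx₀ : x₀ ∈ offAxis) :
    P {ω | ∃ s, spRad (x₀ + W s ω) = 0} = 0 := by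
  have hr₀ : 0 < spRad x₀ := spRad_pos_of_mem hx₀
  -- the events `B n R = {∃ s ≤ n, |w_s| = 0} ∩ {∀ s ≤ n, |w_s| < R}` are null
  set B : ℕ → ℕ → Set Ω := fun n R ↦
    {ω | (∃ s ≤ (n : ℝ≥0), spRad (x₀ + W s ω) = 0) ∧ ∀ s ≤ (n : ℝ≥0), spRad (x₀ + W s ω) < R} with hB
  have hBnull : ∀ n R, P (B n R) = 0 := by
    intro n R
    by_cases hR : spRad x₀ < R
    · -- `B n R ⊆ {T_ε ≤ n, T_R > n}` for every small `ε`
      refine le_antisymm (ENNReal.le_of_forall_pos_le_add fun δ hδ _ ↦ ?_) bot_le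
      rw [zero_add]
      set ε : ℝ := min (spRad x₀ / 2) (δ * spRad x₀) with hεdef
      have hε : 0 < ε := lt_min (by positivity) (by positivity)
      have hεx : ε < spRad x₀ := (min_le_left _ _).trans_lt (by linarith)
      have hεδ : ε / spRad x₀ ≤ δ := by
        rw [div_le_iff₀ hr₀]; exact min_le_right _ _
      calc P (B n R) ≤ P {ω | hitTime x₀ W (innerSet ε) ω ≤ (n : ℝ≥0) ∧
            ¬ hitTime x₀ W (outerSet R) ω ≤ (n : ℝ≥0)} := measure_mono fun ω hω ↦ ?_
        _ ≤ ENNReal.ofReal (ε / spRad x₀) := hW.measure_hit_inner_le hε hεx hR n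
        _ ≤ (δ : ℝ≥0∞) := by
            rw [← ENNReal.ofReal_coe_nnreal]; exact ENNReal.ofReal_le_ofReal hεδ
      obtain ⟨⟨s, hs, hs0⟩, hlt⟩ := hω
      refine ⟨(hitTime_le_of_mem (show spRad (x₀ + W s ω) ≤ ε by rw [hs0]; exact hε.le)).trans
        (by exact_mod_cast hs), fun h ↦ ?_⟩
      obtain ⟨j, hj, hjmem⟩ := (hW.hitTime_le_coe_iff (isClosed_outerSet R)).1 h
      exact absurd hjmem (not_le.2 (hlt j hj))
    · have : B n R = ∅ := by
        ext ω
        simp only [hB, mem_setOf_eq, mem_empty_iff_false, iff_false, not_and]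
        intro _ h
        have := h 0 bot_le
        rw [hW.apply_zero, add_zero] at this
        exact hR this
      rw [this, measure_empty]
  have hsub : {ω | ∃ s, spRad (x₀ + W s ω) = 0} ⊆ ⋃ n, ⋃ R, B n R := by
    rintro ω ⟨s, hs⟩
    obtain ⟨n, hn⟩ := exists_nat_ge s
    obtain ⟨R, -, hR⟩ := hW.exists_nat_gt_spRad x₀ (n : ℝ≥0) ω 0
    have hn' : s ≤ (n : ℝ≥0) := by exact_mod_cast hn
    exact mem_iUnion.2 ⟨n, mem_iUnion.2 ⟨R, ⟨s, hn', hs⟩, hR⟩⟩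
  exact measure_mono_null hsub (measure_iUnion_null fun n ↦ measure_iUnion_null fun R ↦ hBnull n R)

/-! ### The weak Markov property for events of the future path -/

section Markov

variable {d : ℕ} {W' : ℝ≥0 → Ω → (Fin d → ℝ)}

/-- **Markov factorisation for the shifted path.** For a measurable set `E` of pairs
(point, path): `P{(x₀ + W_{s₀}, shifted path) ∈ E} = E[ ψ(x₀ + W_{s₀}) ]` with
`ψ(a) = P{(a, whole path) ∈ E}` (independence of the shifted path from `𝓕_{s₀}` and equality of
its law with the law of the path). [cite: Legall2016, Ch. 2 (simple Markov property of Brownian motion)] -/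
theorem measureReal_shift_mem_eq_integral [IsProbabilityMeasure P] (hW : IsBrownianVec W' P)
    (x₀ : Fin d → ℝ) (s₀ : ℝ≥0) {E : Set ((Fin d → ℝ) × (ℝ≥0 → (Fin d → ℝ)))} (hE : MeasurableSet E) :
    P.real {ω | (x₀ + W' s₀ ω, vecShift W' s₀ ω) ∈ E} =
      ∫ ω, P.real {ω' | (x₀ + W' s₀ ω, vecPath W' ω') ∈ E} ∂P := by
  have hle : hW.natFiltration s₀ ≤ mΩ := hW.natFiltration.le s₀
  set U : Ω → (Fin d → ℝ) := fun ω ↦ x₀ + W' s₀ ω with hU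
  have hUm' : Measurable[hW.natFiltration s₀] U := measurable_const.add (hW.measurable_apply_le le_rfl)
  have hUm : Measurable U := hUm'.mono hle le_rfl
  have hξm : Measurable (vecShift W' s₀) := hW.measurable_vecShift s₀
  have hind : IndepFun U (vecShift W' s₀) P := by
    rw [IndepFun_iff_Indep]
    exact indep_of_indep_of_le_left (hW.indep_comap_vecShift_natFiltration s₀).symm hUm'.comap_le
  have key := integral_comp_eq_integral_integral_of_indepFun hUm hξm hind
    ((measurable_const (a := (1 : ℝ))).indicator hE) (C := 1) fun p ↦ by
      by_cases hp : p ∈ E <;> simp [hp]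
  -- left side
  have hL : ∫ ω, E.indicator (fun _ ↦ (1 : ℝ)) (U ω, vecShift W' s₀ ω) ∂P =
      P.real {ω | (x₀ + W' s₀ ω, vecShift W' s₀ ω) ∈ E} := by
    have hset : {ω | (x₀ + W' s₀ ω, vecShift W' s₀ ω) ∈ E} = (fun ω ↦ (U ω, vecShift W' s₀ ω)) ⁻¹' E := rfl
    have hfun : (fun ω ↦ E.indicator (fun _ ↦ (1 : ℝ)) (U ω, vecShift W' s₀ ω)) =
        ((fun ω ↦ (U ω, vecShift W' s₀ ω)) ⁻¹' E).indicator 1 := by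
      funext ω
      rfl
    rw [hset, hfun, integral_indicator_one ((hUm.prodMk hξm) hE)]
  -- right side, inner integral
  have hR : ∀ ω, ∫ e, E.indicator (fun _ ↦ (1 : ℝ)) (U ω, e) ∂(P.map (vecShift W' s₀)) =
      P.real {ω' | (x₀ + W' s₀ ω, vecPath W' ω') ∈ E} := by
    intro ω
    rw [hW.map_shift s₀]
    have hslice : MeasurableSet (Prod.mk (U ω) ⁻¹' E) := measurable_prodMk_left hE
    have hfun : (fun e ↦ E.indicator (fun _ ↦ (1 : ℝ)) (U ω, e)) = (Prod.mk (U ω) ⁻¹' E).indicator 1 := by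
      funext e
      rfl
    have hset : {ω' | (x₀ + W' s₀ ω, vecPath W' ω') ∈ E} = vecPath W' ⁻¹' (Prod.mk (U ω) ⁻¹' E) := rfl
    rw [hfun, integral_indicator_one hslice, hset, Measure.real, Measure.real,
      Measure.map_apply hW.measurable_vecPath hslice]
  rw [← hL, key]
  exact integral_congr_ae (ae_of_all _ hR)

/-- Measurability of `a ↦ P{(a, path) ∈ E}`. [folklore] -/
theorem measurable_measureReal_path_mem (hW : IsBrownianVec W' P) [IsProbabilityMeasure P]
    {E : Set ((Fin d → ℝ) × (ℝ≥0 → (Fin d → ℝ)))} (hE : MeasurableSet E) :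
    Measurable fun a ↦ P.real {ω' | (a, vecPath W' ω') ∈ E} := by
  have h1 : Measurable fun a ↦ (P.map (vecPath W')) (Prod.mk a ⁻¹' E) := measurable_measure_prodMk_left hE
  have h2 : (fun a ↦ P.real {ω' | (a, vecPath W' ω') ∈ E}) = fun a ↦ ((P.map (vecPath W')) (Prod.mk a ⁻¹' E)).toReal := by
    funext a
    rw [Measure.map_apply hW.measurable_vecPath (measurable_prodMk_left hE)]
    rfl
  rw [h2]
  exact h1.ennreal_toReal

end Markov

/-! ### The Gaussian marginal does not charge the axis; no return to the axis at positive times -/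

/-- **`P(w_{s₀} ∈ axis) = 0` for `s₀ > 0`** (the marginal is Gaussian, non-degenerate). [folklore] -/
theorem measure_spRad_apply_eq_zero [IsProbabilityMeasure P] (hW : IsBrownianVec W P) (x₀ : Fin 4 → ℝ)
    {s₀ : ℝ≥0} (hs₀ : s₀ ≠ 0) : P {ω | spRad (x₀ + W s₀ ω) = 0} = 0 := by
  have hsub : {ω | spRad (x₀ + W s₀ ω) = 0} ⊆ W s₀ ⁻¹' {v | v 1 = -x₀ 1} := fun ω hω ↦ by
    have := apply_one_eq_zero_of_spRad_eq_zero hω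
    simp only [Pi.add_apply] at this
    show W s₀ ω 1 = -x₀ 1
    linarith
  refine measure_mono_null hsub ?_
  have hmeas : MeasurableSet {v : Fin 4 → ℝ | v 1 = -x₀ 1} := measurableSet_eq_fun (measurable_pi_apply 1) measurable_const
  rw [← Measure.map_apply (hW.measurable s₀) hmeas, hW.map_apply s₀]
  have h2 : {v : Fin 4 → ℝ | v 1 = -x₀ 1} = (fun v : Fin 4 → ℝ ↦ v 1) ⁻¹' {-x₀ 1} := rfl
  rw [h2, ← Measure.map_apply (measurable_pi_apply 1) (measurableSet_singleton _), gaussVec_map_eval]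
  haveI := nullSingletonClass_gaussianReal (μ := 0) hs₀
  exact measure_singleton _

/-- The approach event on a time window of length `N`: for every `m` some (clamped rational) time
`u ≤ N` has `|w(a + γ_u)| < 1/(m+1)`. [folklore] -/
def approachSet (N : ℕ) : Set ((Fin 4 → ℝ) × (ℝ≥0 → (Fin 4 → ℝ))) :=
  ⋂ m : ℕ, ⋃ q : ℚ, {p | spRad (p.1 + p.2 (min (q : ℝ).toNNReal N)) < 1 / ((m : ℝ) + 1)}

/-- The approach event is measurable. [folklore] -/
theorem measurableSet_approachSet (N : ℕ) : MeasurableSet (approachSet N) := by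
  refine MeasurableSet.iInter fun m ↦ MeasurableSet.iUnion fun q ↦ ?_
  exact measurableSet_lt (continuous_spRad.measurable.comp
    (measurable_fst.add ((measurable_pi_apply _).comp measurable_snd))) measurable_const

/-- A continuous path meeting the axis within `[0, N]` lies in the approach event. [folklore] -/
theorem mem_approachSet_of_exists {N : ℕ} {a : Fin 4 → ℝ} {γ : ℝ≥0 → (Fin 4 → ℝ)} (hγ : Continuous γ)
    (h : ∃ u : ℝ≥0, u ≤ N ∧ spRad (a + γ u) = 0) : (a, γ) ∈ approachSet N := by
  obtain ⟨u, huN, hu0⟩ := h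
  refine mem_iInter.2 fun m ↦ mem_iUnion.2 ?_
  have hcont : Continuous fun v : ℝ≥0 ↦ spRad (a + γ v) := continuous_spRad.comp (continuous_const.add hγ)
  have hopen : IsOpen {v : ℝ≥0 | spRad (a + γ v) < 1 / ((m : ℝ) + 1)} := isOpen_lt hcont continuous_const
  have hmem : u ∈ {v : ℝ≥0 | spRad (a + γ v) < 1 / ((m : ℝ) + 1)} := by
    show spRad (a + γ u) < 1 / ((m : ℝ) + 1); rw [hu0]; positivity
  obtain ⟨δ, hδ, hball⟩ := Metric.isOpen_iff.1 hopen u hmem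
  obtain ⟨q, hq1, hq2⟩ := exists_rat_btwn (show (u : ℝ) < u + δ by linarith)
  refine ⟨q, hball ?_⟩
  rw [Metric.mem_ball]
  have hq0 : (0 : ℝ) ≤ q := u.coe_nonneg.trans hq1.le
  have hqnn : ((q : ℝ).toNNReal : ℝ) = q := Real.coe_toNNReal _ hq0
  rw [NNReal.dist_eq, NNReal.coe_min, hqnn]
  have huN' : (u : ℝ) ≤ N := by exact_mod_cast huN
  rw [abs_sub_lt_iff]
  constructor
  · calc min (q : ℝ) N - u ≤ q - u := by gcongr; exact min_le_left _ _
      _ < δ := by linarith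
  · have : (u : ℝ) ≤ min (q : ℝ) N := le_min hq1.le huN'
    push_cast [this]
    linarith

/-- Conversely, a continuous path in the approach event meets the axis within `[0, N]`
(compactness of `[0, N]`). [folklore] -/
theorem exists_of_mem_approachSet {N : ℕ} {a : Fin 4 → ℝ} {γ : ℝ≥0 → (Fin 4 → ℝ)} (hγ : Continuous γ)
    (h : (a, γ) ∈ approachSet N) : ∃ u : ℝ≥0, u ≤ N ∧ spRad (a + γ u) = 0 := by
  have hcont : Continuous fun v : ℝ≥0 ↦ spRad (a + γ v) := continuous_spRad.comp (continuous_const.add hγ)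
  -- times `u m ≤ N` with `spRad < 1/(m+1)`
  have hch : ∀ m : ℕ, ∃ u : ℝ≥0, u ≤ N ∧ spRad (a + γ u) < 1 / ((m : ℝ) + 1) := fun m ↦ by
    obtain ⟨q, hq⟩ := mem_iUnion.1 (mem_iInter.1 h m)
    exact ⟨min (q : ℝ).toNNReal N, min_le_right _ _, hq⟩
  choose u huN hu using hch
  obtain ⟨v, hv, φ, hφ, hlim⟩ := (isCompact_Icc (a := (0 : ℝ≥0)) (b := N)).tendsto_subseq
    (fun m ↦ (⟨bot_le, huN m⟩ : u m ∈ Icc (0 : ℝ≥0) N))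
  refine ⟨v, hv.2, le_antisymm ?_ (spRad_nonneg _)⟩
  have h1 : Tendsto (fun k ↦ spRad (a + γ (u (φ k)))) atTop (𝓝 (spRad (a + γ v))) :=
    (hcont.tendsto v).comp hlim
  have h2 : Tendsto (fun k : ℕ ↦ 1 / ((φ k : ℝ) + 1)) atTop (𝓝 0) := by
    have hφ' : Tendsto (fun k ↦ (φ k : ℝ)) atTop atTop :=
      tendsto_natCast_atTop_atTop.comp hφ.tendsto_atTop
    exact tendsto_one_div_add_atTop_nhds_zero_nat.comp hφ.tendsto_atTop
  exact le_of_tendsto_of_tendsto' h1 h2 fun k ↦ (hu (φ k)).le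

/-- **No return to the axis after time `s₀ > 0`, from ANY starting point**: a.s. `w_s ≠ 0` for
all `s ≥ s₀` (weak Markov property at `s₀`; the marginal does not charge the axis, and the axis
is polar off the axis). [cite: Legall2016, Ch. 7 Prop. 7.16] -/
theorem measure_exists_spRad_eq_zero_of_le [IsProbabilityMeasure P] (hW : IsBrownianVec W P)
    (x₀ : Fin 4 → ℝ) {s₀ : ℝ≥0} (hs₀ : s₀ ≠ 0) :
    P {ω | ∃ s, s₀ ≤ s ∧ spRad (x₀ + W s ω) = 0} = 0 := by
  -- windows of length `N`
  have hwin : ∀ N : ℕ, P {ω | (x₀ + W s₀ ω, vecShift W s₀ ω) ∈ approachSet N} = 0 := by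
    intro N
    have hmeas : MeasurableSet {ω | (x₀ + W s₀ ω, vecShift W s₀ ω) ∈ approachSet N} :=
      ((measurable_const.add (hW.measurable s₀)).prodMk (hW.measurable_vecShift s₀)) (measurableSet_approachSet N)
    rw [← measureReal_eq_zero_iff (measure_ne_top _ _)]
    refine le_antisymm ?_ measureReal_nonneg
    rw [hW.measureReal_shift_mem_eq_integral x₀ s₀ (measurableSet_approachSet N)]
    -- `ψ(a) ≤ 𝟙{a ∈ axis}`
    set ψ : (Fin 4 → ℝ) → ℝ := fun a ↦ P.real {ω' | (a, vecPath W ω') ∈ approachSet N} with hψ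
    have hψ0 : ∀ a ∈ offAxis, ψ a = 0 := fun a ha ↦ by
      refine le_antisymm ?_ measureReal_nonneg
      calc ψ a ≤ P.real {ω' | ∃ s, spRad (a + W s ω') = 0} := measureReal_mono (fun ω' hω' ↦ ?_)
        _ = 0 := by rw [Measure.real, hW.measure_exists_spRad_eq_zero ha, ENNReal.toReal_zero]
      obtain ⟨u, -, hu⟩ := exists_of_mem_approachSet (hW.continuous_path ω') hω'
      exact ⟨u, hu⟩
    have hψ1 : ∀ a, ψ a ≤ 1 := fun a ↦ measureReal_le_one
    have hψm : Measurable ψ := hW.measurable_measureReal_path_mem (measurableSet_approachSet N)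
    have haxis : MeasurableSet {ω | spRad (x₀ + W s₀ ω) = 0} :=
      measurableSet_eq_fun (continuous_spRad.measurable.comp (measurable_const.add (hW.measurable s₀))) measurable_const
    calc ∫ ω, ψ (x₀ + W s₀ ω) ∂P ≤ ∫ ω, {ω | spRad (x₀ + W s₀ ω) = 0}.indicator 1 ω ∂P := by
          refine integral_mono ?_ ((integrable_const (1 : ℝ)).indicator haxis) fun ω ↦ ?_
          · exact integrable_of_abs_le (hψm.comp (measurable_const.add (hW.measurable s₀))) (C := 1)
              fun ω ↦ by rw [abs_of_nonneg measureReal_nonneg]; exact hψ1 _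
          · by_cases hω : spRad (x₀ + W s₀ ω) = 0
            · simp only [Set.indicator_of_mem (show ω ∈ {ω | spRad (x₀ + W s₀ ω) = 0} from hω), Pi.one_apply]
              exact hψ1 _
            · rw [Set.indicator_of_notMem (show ω ∉ {ω | spRad (x₀ + W s₀ ω) = 0} from hω)]
              exact (hψ0 _ (mem_offAxis_iff_spRad_pos.2 (lt_of_le_of_ne (spRad_nonneg _) (Ne.symm hω)))).le
      _ = P.real {ω | spRad (x₀ + W s₀ ω) = 0} := integral_indicator_one haxis
      _ = 0 := by rw [Measure.real, hW.measure_spRad_apply_eq_zero x₀ hs₀, ENNReal.toReal_zero]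
  -- `{∃ s ≥ s₀, |w_s| = 0} ⊆ ⋃_N {shifted pair ∈ approachSet N}`
  have hsub : {ω | ∃ s, s₀ ≤ s ∧ spRad (x₀ + W s ω) = 0} ⊆
      ⋃ N : ℕ, {ω | (x₀ + W s₀ ω, vecShift W s₀ ω) ∈ approachSet N} := by
    rintro ω ⟨s, hs₀s, hs⟩
    obtain ⟨N, hN⟩ := exists_nat_ge (s - s₀)
    refine mem_iUnion.2 ⟨N, mem_approachSet_of_exists (γ := vecShift W s₀ ω) ?_ ⟨s - s₀, hN, ?_⟩⟩
    · exact ((hW.continuous_path ω).comp (continuous_const.add continuous_id)).sub continuous_const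
    show spRad (x₀ + W s₀ ω + (W (s₀ + (s - s₀)) ω - W s₀ ω)) = 0
    rw [add_tsub_cancel_of_le hs₀s]
    convert hs using 2
    abel
  exact measure_mono_null hsub (measure_iUnion_null hwin)

/-- **A.s., `|w_s| > 0` for every `s > 0`** (from any starting point). [cite: Legall2016, Ch. 7 Prop. 7.16] -/
theorem ae_forall_pos_spRad_pos [IsProbabilityMeasure P] (hW : IsBrownianVec W P) (x₀ : Fin 4 → ℝ) :
    ∀ᵐ ω ∂P, ∀ s : ℝ≥0, 0 < s → 0 < spRad (x₀ + W s ω) := by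
  have hnull : P {ω | ∃ s : ℝ≥0, 0 < s ∧ spRad (x₀ + W s ω) = 0} = 0 := by
    have hsub : {ω | ∃ s : ℝ≥0, 0 < s ∧ spRad (x₀ + W s ω) = 0} ⊆
        ⋃ n : ℕ, {ω | ∃ s, ((n : ℝ≥0) + 1)⁻¹ ≤ s ∧ spRad (x₀ + W s ω) = 0} := by
      rintro ω ⟨s, hs, hs0⟩
      obtain ⟨n, hn⟩ := exists_nat_gt (s : ℝ)⁻¹
      refine mem_iUnion.2 ⟨n, s, ?_, hs0⟩
      have hs' : (0 : ℝ) < s := hs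
      have key : ((n : ℝ) + 1)⁻¹ ≤ s := by
        rw [inv_le_comm₀ (by positivity) hs']
        exact hn.le.trans (by linarith)
      rw [← NNReal.coe_le_coe]
      push_cast
      exact key
    refine measure_mono_null hsub (measure_iUnion_null fun n ↦ ?_)
    exact hW.measure_exists_spRad_eq_zero_of_le x₀ (by positivity)
  rw [ae_iff]
  refine measure_mono_null (fun ω hω ↦ ?_) hnull
  simp only [mem_setOf_eq, not_forall, not_lt, exists_prop] at hω
  obtain ⟨s, hs, hle⟩ := hω
  exact ⟨s, hs, le_antisymm hle (spRad_nonneg _)⟩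

/-! ### Spreading of the Gaussian marginals -/

/-- `N(0, n+1)(−K ≤ · ≤ K) → 0` as `n → ∞`. [folklore] -/
theorem tendsto_gaussianReal_Icc (K : ℝ) :
    Tendsto (fun n : ℕ ↦ gaussianReal 0 ((n : ℝ≥0) + 1) (Icc (-K) K)) atTop (𝓝 0) := by
  rcases lt_or_ge K 0 with hK | hK
  · have : ∀ n : ℕ, gaussianReal 0 ((n : ℝ≥0) + 1) (Icc (-K) K) = 0 := fun n ↦ by
      rw [Icc_eq_empty (by linarith), measure_empty]
    simp_rw [this]
    exact tendsto_const_nhds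
  -- rescale to the standard normal law
  set S : ℕ → Set ℝ := fun n ↦ Icc (-(K / Real.sqrt ((n : ℝ) + 1))) (K / Real.sqrt ((n : ℝ) + 1)) with hS
  have hsq : ∀ n : ℕ, 0 < Real.sqrt ((n : ℝ) + 1) := fun n ↦ Real.sqrt_pos.2 (by positivity)
  have heq : ∀ n : ℕ, gaussianReal 0 ((n : ℝ≥0) + 1) (Icc (-K) K) = gaussianReal 0 1 (S n) := by
    intro n
    rw [gaussianReal_eq_map_sqrt_mul ((n : ℝ≥0) + 1), Measure.map_apply (by fun_prop) measurableSet_Icc]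
    congr 1
    ext x
    have hc : Real.sqrt (((n : ℝ≥0) + 1 : ℝ≥0) : ℝ) = Real.sqrt ((n : ℝ) + 1) := by push_cast; rfl
    simp only [Set.mem_preimage, Set.mem_Icc, hS, hc]
    rw [neg_le, ← neg_div, neg_le, div_le_iff₀ (hsq n), le_div_iff₀ (hsq n)]
    constructor <;> rintro ⟨h1, h2⟩ <;> exact ⟨by nlinarith, by nlinarith⟩
  simp_rw [heq]
  have hanti : Antitone S := by
    intro n m hnm x hx
    have hnm' : (n : ℝ) ≤ m := by exact_mod_cast hnm
    have hle : Real.sqrt ((n : ℝ) + 1) ≤ Real.sqrt ((m : ℝ) + 1) := Real.sqrt_le_sqrt (by linarith)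
    have h1 : K / Real.sqrt ((m : ℝ) + 1) ≤ K / Real.sqrt ((n : ℝ) + 1) :=
      div_le_div_of_nonneg_left hK (hsq n) hle
    simp only [hS, Set.mem_Icc] at hx ⊢
    exact ⟨by linarith [hx.1], hx.2.trans h1⟩
  have hinter : gaussianReal 0 1 (⋂ n, S n) = 0 := by
    have hsub : (⋂ n, S n) ⊆ {0} := by
      intro x hx
      rw [mem_iInter] at hx
      rw [mem_singleton_iff]
      by_contra hx0
      have hxpos : 0 < |x| := abs_pos.2 hx0
      -- `|x| ≤ K/√(n+1)` for all `n`, impossible for `n` large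
      obtain ⟨n, hn⟩ := exists_nat_gt ((K / |x|) ^ 2)
      have hxn := hx n
      simp only [hS, Set.mem_Icc] at hxn
      have habs : |x| ≤ K / Real.sqrt ((n : ℝ) + 1) := abs_le.2 ⟨hxn.1, hxn.2⟩
      rw [le_div_iff₀ (hsq n)] at habs
      have h2 : |x| * Real.sqrt ((n : ℝ) + 1) ≤ K := habs
      have h3 : (|x| * Real.sqrt ((n : ℝ) + 1)) ^ 2 ≤ K ^ 2 := pow_le_pow_left₀ (by positivity) h2 2
      rw [mul_pow, Real.sq_sqrt (by positivity)] at h3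
      have h4 : (K / |x|) ^ 2 * |x| ^ 2 = K ^ 2 := by field_simp
      nlinarith [sq_nonneg x, sq_abs x]
    haveI := nullSingletonClass_gaussianReal (μ := 0) (v := 1) one_ne_zero
    exact measure_mono_null hsub (measure_singleton _)
  have := tendsto_measure_iInter_atTop (μ := gaussianReal 0 1) (fun n ↦ measurableSet_Icc.nullMeasurableSet)
    hanti ⟨0, measure_ne_top _ _⟩
  rwa [hinter] at this

/-- **The marginals spread out**: `P(|w(x₀ + W_{n+1})| ≤ M) → 0`. [folklore] -/
theorem tendsto_measure_spRad_le [IsProbabilityMeasure P] (hW : IsBrownianVec W P) (x₀ : Fin 4 → ℝ) (M : ℝ) :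
    Tendsto (fun n : ℕ ↦ P {ω | spRad (x₀ + W ((n : ℝ≥0) + 1) ω) ≤ M}) atTop (𝓝 0) := by
  set K : ℝ := M + |x₀ 1| with hK
  have hle : ∀ n : ℕ, P {ω | spRad (x₀ + W ((n : ℝ≥0) + 1) ω) ≤ M} ≤ gaussianReal 0 ((n : ℝ≥0) + 1) (Icc (-K) K) := by
    intro n
    have hsub : {ω | spRad (x₀ + W ((n : ℝ≥0) + 1) ω) ≤ M} ⊆
        W ((n : ℝ≥0) + 1) ⁻¹' ((fun v : Fin 4 → ℝ ↦ v 1) ⁻¹' Icc (-K) K) := by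
      intro ω hω
      have h1 := (abs_apply_one_le_spRad _).trans hω
      simp only [Pi.add_apply] at h1
      simp only [Set.mem_preimage, Set.mem_Icc, hK]
      have h2 : |W ((n : ℝ≥0) + 1) ω 1| ≤ M + |x₀ 1| := by
        calc |W ((n : ℝ≥0) + 1) ω 1| = |(x₀ 1 + W ((n : ℝ≥0) + 1) ω 1) - x₀ 1| := by ring_nf
          _ ≤ |x₀ 1 + W ((n : ℝ≥0) + 1) ω 1| + |x₀ 1| := abs_sub _ _
          _ ≤ M + |x₀ 1| := by linarith
      exact abs_le.1 h2
    refine (measure_mono hsub).trans_eq ?_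
    rw [← Measure.map_apply (hW.measurable _) ((measurable_pi_apply 1) measurableSet_Icc), hW.map_apply,
      ← Measure.map_apply (measurable_pi_apply 1) measurableSet_Icc, gaussVec_map_eval]
  exact tendsto_of_tendsto_of_tendsto_of_le_of_le tendsto_const_nhds (tendsto_gaussianReal_Icc K)
    (fun n ↦ bot_le) hle

/-! ### Transience -/

/-- The far-approach event: for every `m` some (rational) time `u` has `|w(a + γ_u)| < ρ + 1/(m+1)`.
[folklore] -/
def farSet (ρ : ℝ) : Set ((Fin 4 → ℝ) × (ℝ≥0 → (Fin 4 → ℝ))) :=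
  ⋂ m : ℕ, ⋃ q : ℚ, {p | spRad (p.1 + p.2 (q : ℝ).toNNReal) < ρ + 1 / ((m : ℝ) + 1)}

/-- The far-approach event is measurable. [folklore] -/
theorem measurableSet_farSet (ρ : ℝ) : MeasurableSet (farSet ρ) := by
  refine MeasurableSet.iInter fun m ↦ MeasurableSet.iUnion fun q ↦ ?_
  exact measurableSet_lt (continuous_spRad.measurable.comp
    (measurable_fst.add ((measurable_pi_apply _).comp measurable_snd))) measurable_const

/-- A continuous path reaching `|w| ≤ ρ` at some time lies in the far-approach event. [folklore] -/
theorem mem_farSet_of_exists {ρ : ℝ} {a : Fin 4 → ℝ} {γ : ℝ≥0 → (Fin 4 → ℝ)} (hγ : Continuous γ)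
    (h : ∃ u : ℝ≥0, spRad (a + γ u) ≤ ρ) : (a, γ) ∈ farSet ρ := by
  obtain ⟨u, hu⟩ := h
  refine mem_iInter.2 fun m ↦ mem_iUnion.2 ?_
  have hcont : Continuous fun v : ℝ≥0 ↦ spRad (a + γ v) := continuous_spRad.comp (continuous_const.add hγ)
  have hopen : IsOpen {v : ℝ≥0 | spRad (a + γ v) < ρ + 1 / ((m : ℝ) + 1)} := isOpen_lt hcont continuous_const
  have hmem : u ∈ {v : ℝ≥0 | spRad (a + γ v) < ρ + 1 / ((m : ℝ) + 1)} := by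
    show spRad (a + γ u) < ρ + 1 / ((m : ℝ) + 1)
    have : (0 : ℝ) < 1 / ((m : ℝ) + 1) := by positivity
    linarith
  obtain ⟨δ, hδ, hball⟩ := Metric.isOpen_iff.1 hopen u hmem
  obtain ⟨q, hq1, hq2⟩ := exists_rat_btwn (show (u : ℝ) < u + δ by linarith)
  refine ⟨q, hball ?_⟩
  rw [Metric.mem_ball]
  have hq0 : (0 : ℝ) ≤ q := u.coe_nonneg.trans hq1.le
  rw [NNReal.dist_eq, Real.coe_toNNReal _ hq0, abs_sub_lt_iff]
  constructor <;> linarith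

/-- A path of `W` in the far-approach event of `a` reaches `|w| ≤ ρ + 1`. [folklore] -/
theorem hitTime_ne_top_of_mem_farSet {ρ : ℝ} {a : Fin 4 → ℝ} {ω' : Ω}
    (h : (a, vecPath W ω') ∈ farSet ρ) : hitTime a W (innerSet (ρ + 1)) ω' ≠ ⊤ := by
  obtain ⟨q, hq⟩ := mem_iUnion.1 (mem_iInter.1 h 0)
  simp only [Nat.cast_zero, zero_add, div_one, mem_setOf_eq] at hq
  have hmem : a + W ((q : ℝ).toNNReal) ω' ∈ innerSet (ρ + 1) := hq.le
  exact ne_top_of_le_ne_top WithTop.coe_ne_top (hitTime_le_of_mem hmem)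

/-- **Transience of the spatial Brownian motion**: almost surely `|w_t| → ∞` (Le Gall Thm. 7.17
(ii) for the three-dimensional Brownian motion `w`). [cite: Legall2016, Ch. 7 Thm. 7.17 (ii)] -/
theorem ae_tendsto_spRad_atTop [IsProbabilityMeasure P] (hW : IsBrownianVec W P) (x₀ : Fin 4 → ℝ) :
    ∀ᵐ ω ∂P, Tendsto (fun t ↦ spRad (x₀ + W t ω)) atTop atTop := by
  -- `D r n`: after time `n + 1` the path approaches the axis within `r`
  set D : ℕ → ℕ → Set Ω := fun r n ↦
    {ω | (x₀ + W ((n : ℝ≥0) + 1) ω, vecShift W ((n : ℝ≥0) + 1) ω) ∈ farSet r} with hD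
  -- the bound `ψ(a) ≤ (r+1)/|w(a)|`
  have hψ : ∀ (r : ℕ) (a : Fin 4 → ℝ), (r : ℝ) + 1 < spRad a →
      P.real {ω' | (a, vecPath W ω') ∈ farSet r} ≤ ((r : ℝ) + 1) / spRad a := by
    intro r a ha
    calc P.real {ω' | (a, vecPath W ω') ∈ farSet r}
        ≤ P.real {ω' | hitTime a W (innerSet ((r : ℝ) + 1)) ω' ≠ ⊤} :=
          measureReal_mono fun ω' hω' ↦ hitTime_ne_top_of_mem_farSet hω'
      _ ≤ ((r : ℝ) + 1) / spRad a := by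
          have h1 := hW.measure_hitTime_inner_ne_top_le (x₀ := a) (ε := (r : ℝ) + 1) (by positivity) ha
          have h2 : 0 ≤ ((r : ℝ) + 1) / spRad a := by
            have : 0 < spRad a := lt_trans (by positivity) ha
            positivity
          rw [Measure.real, ← ENNReal.toReal_ofReal h2]
          exact ENNReal.toReal_mono ENNReal.ofReal_ne_top h1
  -- `P(D r n) ≤ P(|w_{n+1}| ≤ M) + (r+1)/M`
  have hDle : ∀ (r n : ℕ) (M : ℝ), (r : ℝ) + 1 < M →
      P.real (D r n) ≤ P.real {ω | spRad (x₀ + W ((n : ℝ≥0) + 1) ω) ≤ M} + ((r : ℝ) + 1) / M := by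
    intro r n M hM
    have hM0 : 0 < M := lt_trans (by positivity) hM
    rw [hD]
    simp only []
    rw [hW.measureReal_shift_mem_eq_integral x₀ _ (measurableSet_farSet r)]
    have hmeasM : MeasurableSet {ω | spRad (x₀ + W ((n : ℝ≥0) + 1) ω) ≤ M} :=
      measurableSet_le (continuous_spRad.measurable.comp (measurable_const.add (hW.measurable _))) measurable_const
    have hψm : Measurable fun a ↦ P.real {ω' | (a, vecPath W ω') ∈ farSet r} :=
      hW.measurable_measureReal_path_mem (measurableSet_farSet r)
    calc ∫ ω, P.real {ω' | (x₀ + W ((n : ℝ≥0) + 1) ω, vecPath W ω') ∈ farSet r} ∂P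
        ≤ ∫ ω, ({ω | spRad (x₀ + W ((n : ℝ≥0) + 1) ω) ≤ M}.indicator (fun _ ↦ (1 : ℝ)) ω + ((r : ℝ) + 1) / M) ∂P := by
          refine integral_mono ?_ (((integrable_const (1 : ℝ)).indicator hmeasM).add (integrable_const _)) fun ω ↦ ?_
          · exact integrable_of_abs_le (hψm.comp (measurable_const.add (hW.measurable _))) (C := 1)
              fun ω ↦ by rw [abs_of_nonneg measureReal_nonneg]; exact measureReal_le_one
          · by_cases hω : spRad (x₀ + W ((n : ℝ≥0) + 1) ω) ≤ M
            · rw [Set.indicator_of_mem (show ω ∈ {ω | spRad (x₀ + W ((n : ℝ≥0) + 1) ω) ≤ M} from hω)]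
              have : 0 ≤ ((r : ℝ) + 1) / M := by positivity
              linarith [measureReal_le_one (μ := P) (s := {ω' | (x₀ + W ((n : ℝ≥0) + 1) ω, vecPath W ω') ∈ farSet r})]
            · rw [Set.indicator_of_notMem (show ω ∉ {ω | spRad (x₀ + W ((n : ℝ≥0) + 1) ω) ≤ M} from hω), zero_add]
              push Not at hω
              exact (hψ r _ (hM.trans hω)).trans (div_le_div_of_nonneg_left (by positivity) hM0 hω.le)
      _ = P.real {ω | spRad (x₀ + W ((n : ℝ≥0) + 1) ω) ≤ M} + ((r : ℝ) + 1) / M := by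
          rw [integral_add ((integrable_const (1 : ℝ)).indicator hmeasM) (integrable_const _),
            integral_indicator_const _ hmeasM, integral_const]
          simp
  -- hence `P(D r n) → 0`
  have hDlim : ∀ r : ℕ, Tendsto (fun n ↦ P (D r n)) atTop (𝓝 0) := by
    intro r
    have hreal : Tendsto (fun n ↦ P.real (D r n)) atTop (𝓝 0) := by
      rw [Metric.tendsto_nhds]
      intro δ hδ
      set M : ℝ := max (2 * ((r : ℝ) + 1) / δ) ((r : ℝ) + 2) with hMdef
      have hM : (r : ℝ) + 1 < M := lt_of_lt_of_le (by linarith) (le_max_right _ _)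
      have hM0 : 0 < M := lt_trans (by positivity) hM
      have hrM : ((r : ℝ) + 1) / M ≤ δ / 2 := by
        rw [div_le_iff₀ hM0]
        have : 2 * ((r : ℝ) + 1) / δ ≤ M := le_max_left _ _
        rw [div_le_iff₀ hδ] at this
        linarith
      have hsp := hW.tendsto_measure_spRad_le x₀ M
      have hsp' : Tendsto (fun n : ℕ ↦ P.real {ω | spRad (x₀ + W ((n : ℝ≥0) + 1) ω) ≤ M}) atTop (𝓝 0) := by
        have h := (ENNReal.tendsto_toReal ENNReal.zero_ne_top).comp hsp
        rw [ENNReal.toReal_zero] at h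
        exact h
      rw [Metric.tendsto_nhds] at hsp'
      filter_upwards [hsp' (δ / 2) (by positivity)] with n hn
      rw [Real.dist_eq, sub_zero, abs_of_nonneg measureReal_nonneg] at hn ⊢
      linarith [hDle r n M hM]
    have := (ENNReal.tendsto_ofReal hreal)
    simp only [ENNReal.ofReal_zero] at this
    refine this.congr fun n ↦ ?_
    exact ofReal_measureReal (measure_ne_top _ _)
  -- the null set
  have hnull : P (⋃ r : ℕ, ⋂ n : ℕ, D r n) = 0 := by
    refine measure_iUnion_null fun r ↦ le_antisymm ?_ bot_le
    exact ge_of_tendsto' (hDlim r) fun n ↦ measure_mono (iInter_subset _ n)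
  -- off the null set the radius tends to infinity
  rw [ae_iff]
  refine measure_mono_null (fun ω hω ↦ ?_) hnull
  simp only [mem_setOf_eq] at hω
  rw [mem_iUnion]
  by_contra hgood
  push Not at hgood
  apply hω
  rw [tendsto_atTop_atTop]
  intro b
  obtain ⟨r, hr⟩ := exists_nat_ge b
  have hr' := hgood r
  rw [mem_iInter, not_forall] at hr'
  obtain ⟨n, hn⟩ := hr'
  refine ⟨(n : ℝ≥0) + 1, fun t ht ↦ ?_⟩
  by_contra hlt
  push Not at hlt
  apply hn
  show (x₀ + W ((n : ℝ≥0) + 1) ω, vecShift W ((n : ℝ≥0) + 1) ω) ∈ farSet r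
  refine mem_farSet_of_exists (((hW.continuous_path ω).comp (continuous_const.add continuous_id)).sub
    continuous_const) ⟨t - ((n : ℝ≥0) + 1), ?_⟩
  show spRad (x₀ + W ((n : ℝ≥0) + 1) ω + (W ((n : ℝ≥0) + 1 + (t - ((n : ℝ≥0) + 1))) ω - W ((n : ℝ≥0) + 1) ω)) ≤ r
  rw [add_tsub_cancel_of_le ht]
  have : x₀ + W ((n : ℝ≥0) + 1) ω + (W t ω - W ((n : ℝ≥0) + 1) ω) = x₀ + W t ω := by abel
  rw [this]
  exact hlt.le.trans hr

end IsBrownianVec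

end Literature.Probability.Process

end
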